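import Literature.Barriers.ValiantsHypothesis.CKRST20NaturalProofsExist
import Literature.Computability.AlgebraicComplexity.CircuitCount
import Literature.Computability.AlgebraicComplexity.HittingSetsFiniteClass
import HarnessLib

/-!
# CKRST 2020, v2 ‹Lemmas 11, 16› = arXiv v4 Lemmas 3.8–3.9: non-explicit hitting sets over finite
# fields for `𝒞(n,d,s)` and `𝒟(n,d,s)` — proofs

Discharges of the two finite-field hitting-set facts of `CKRST20NaturalProofsExist.lean`
(P. Chatterjee, M. Kumar, C. Ramya, R. Saptharishi, A. Tengse, *On the existence of algebraically
natural proofs*, arXiv:2004.14147; v4 Lemma 3.8 = ECCC Lemma 3.1 = v2 ‹Lemma 11›, v4 Lemma 3.9 =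
ECCC Lemma 5.3 = v2 ‹Lemma 16›), following the printed proofs ([F14, Lemma 3.2.14]: COUNT the
class, then a union bound of the polynomial identity lemma over independent uniform points):

* `CKRST2020_lemma11_holds : CKRST2020_lemma11` — `|𝔽| ≥ d²`: a hitting set for the degree-`≤ d`,
  size-`≤ s`, `n`-variate polynomials of size `≤ 40·s·(log₂ n + log₂ s + 1)`;
* `CKRST2020_lemma16_holds : CKRST2020_lemma16` — the same for the `s`-definable polynomials, size
  `≤ 40·s·(log₂ s + 1)`.

Ingredients: the circuit count in the tree's gate model
(`CircuitCount.exists_finset_complexity_le`, v4 Claim 3.10 = [F14, Lemma 3.1.6]: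
`≤ (2q²(n+q+s)²)^s (n+q+s)` polynomials of complexity `≤ s` over a field with `q` elements; for
‹Lemma 16› applied to the `s`-variate polynomials `g` with `f = Σ_{α ∈ {0,1}^{s-n}} g(x, α)`, v4
Claim 3.11's count of `𝒟(n,d,s)`), and the finite-class hitting-set lemma
(`FiniteClass.exists_hittingSet`, v4 Claim 3.11 = [F14, Lemma 3.2.13]) with `S = 𝔽` and an even
number `t = 2u` of points, so that `d^t = (d²)^u ≤ q^u` under the printed hypothesis `|𝔽| ≥ d²`.
The printed constants (`⌈2s(log n + 2 log s + 4)⌉`, `⌈2s(3 log s + 4)⌉`) refer to [F14]'s gate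
model; the facts are typed with an absolute constant, realised here as `C = 40`.

## References

* [ChatterjeeKumarRamyaSaptharishiTengse2020] arXiv:2004.14147 v4 Lemmas 3.8–3.9, Claims 3.10–3.11
  (v2 ‹Lemmas 11, 16›, ‹Claims 17, 18›; locators paper:arxiv-2004.14147 p0010.txt:L5,
  p0013.txt:L19–L34); ECCC TR20-063 Lemmas 3.1, 5.3.
* [Forbes2014] M. A. Forbes, PhD thesis (MIT 2014), Lemmas 3.1.6, 3.2.13, 3.2.14 (as cited).
-/

noncomputable section

namespace Literature.Barriers.ValiantsHypothesis

open Literature.Computability.AlgebraicComplexity MvPolynomial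

section FiniteFieldHittingSets

namespace CKRST2020

/-- The size of the circuit count as a power of `q`: if `N + q + s ≤ q^A` then
`(2q²(N+q+s)²)^s (N+q+s) ≤ q^{(3A+3)s}` (`s ≥ 1`, `q ≥ 2`).
[cite: ChatterjeeKumarRamyaSaptharishiTengse2020, Lemma 3.8 (arXiv v4), proof] -/
private theorem count_le_pow {q s N A : ℕ} (hs : 1 ≤ s) (hq : 2 ≤ q) (hN : N + q + s ≤ q ^ A) :
    (2 * q ^ 2 * (N + q + s) ^ 2) ^ s * (N + q + s) ≤ q ^ ((3 * A + 3) * s) := by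
  have hq1 : 1 ≤ q := le_trans one_le_two hq
  have h1 : 2 * q ^ 2 * (N + q + s) ^ 2 ≤ q ^ (2 * A + 3) :=
    calc 2 * q ^ 2 * (N + q + s) ^ 2 ≤ q * q ^ 2 * (q ^ A) ^ 2 :=
          Nat.mul_le_mul (Nat.mul_le_mul_right _ hq) (Nat.pow_le_pow_left hN 2)
      _ = q ^ (2 * A + 3) := by ring
  have h2 : N + q + s ≤ q ^ (A * s) :=
    hN.trans (Nat.pow_le_pow_right hq1 (Nat.le_mul_of_pos_right A hs))
  calc (2 * q ^ 2 * (N + q + s) ^ 2) ^ s * (N + q + s)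
      ≤ (q ^ (2 * A + 3)) ^ s * q ^ (A * s) := Nat.mul_le_mul (Nat.pow_le_pow_left h1 s) h2
    _ = q ^ ((3 * A + 3) * s) := by rw [← pow_mul, ← pow_add]; congr 1; ring

/-- The union-bound inequality `#𝒞 · d^{2u} < q^{2u}` from `#𝒞 ≤ q^a`, `a < u`, `d² ≤ q`.
[cite: ChatterjeeKumarRamyaSaptharishiTengse2020, Lemma 3.8 (arXiv v4), proof] -/
private theorem card_mul_pow_lt {c q a u d : ℕ} (hc : c ≤ q ^ a) (hau : a < u) (hq : 2 ≤ q)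
    (hd : d ^ 2 ≤ q) : c * d ^ (2 * u) < q ^ (2 * u) := by
  have hqa : q ^ a < q ^ u := Nat.pow_lt_pow_right (by omega) hau
  have hdu : d ^ (2 * u) ≤ q ^ u := by rw [pow_mul]; exact Nat.pow_le_pow_left hd u
  calc c * d ^ (2 * u) ≤ q ^ a * q ^ u := Nat.mul_le_mul hc hdu
    _ < q ^ u * q ^ u := Nat.mul_lt_mul_of_pos_right hqa (Nat.pow_pos (by omega))
    _ = q ^ (2 * u) := by rw [← pow_add, two_mul]

/-- `2s + q ≤ q^{log₂ s + 3}` for `s ≥ 1`, `q ≥ 2`.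
[cite: ChatterjeeKumarRamyaSaptharishiTengse2020, Lemma 3.9 (arXiv v4), proof] -/
private theorem two_s_add_q_le {s q : ℕ} (hs : 1 ≤ s) (hq : 2 ≤ q) :
    s + q + s ≤ q ^ (Nat.log 2 s + 3) := by
  have hsL : s < 2 ^ (Nat.log 2 s + 1) := Nat.lt_pow_succ_log_self one_lt_two s
  have h1 : s + q + s ≤ 2 * s * q := by nlinarith
  have h2 : 2 * s ≤ 2 ^ (Nat.log 2 s + 2) := by rw [pow_succ]; omega
  calc s + q + s ≤ 2 * s * q := h1
    _ ≤ 2 ^ (Nat.log 2 s + 2) * q := Nat.mul_le_mul_right _ h2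
    _ ≤ q ^ (Nat.log 2 s + 2) * q := Nat.mul_le_mul_right _ (Nat.pow_le_pow_left hq _)
    _ = q ^ (Nat.log 2 s + 3) := by ring

/-- `n + q + s ≤ q^{log₂ n + log₂ s + 5}` for `n, s ≥ 1`, `q ≥ 2`.
[cite: ChatterjeeKumarRamyaSaptharishiTengse2020, Lemma 3.8 (arXiv v4), proof] -/
private theorem n_add_q_add_s_le {n s q : ℕ} (hn : 1 ≤ n) (hs : 1 ≤ s) (hq : 2 ≤ q) :
    n + q + s ≤ q ^ (Nat.log 2 n + Nat.log 2 s + 5) := by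
  have hnL : n < 2 ^ (Nat.log 2 n + 1) := Nat.lt_pow_succ_log_self one_lt_two n
  have hsL : s < 2 ^ (Nat.log 2 s + 1) := Nat.lt_pow_succ_log_self one_lt_two s
  have hns : 1 ≤ n * s := Nat.one_le_iff_ne_zero.2 (by positivity)
  have h_n : n ≤ n * s := Nat.le_mul_of_pos_right n hs
  have h_s : s ≤ n * s := Nat.le_mul_of_pos_left s hn
  have h_q : q ≤ n * s * q := Nat.le_mul_of_pos_left q hns
  have h_nsq : n * s ≤ n * s * q := Nat.le_mul_of_pos_right _ (by omega)
  have h1 : n + q + s ≤ 4 * (n * s) * q := by linarith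
  have h2 : 4 * (n * s) ≤ 2 ^ (Nat.log 2 n + Nat.log 2 s + 4) := by
    calc 4 * (n * s) ≤ 4 * (2 ^ (Nat.log 2 n + 1) * 2 ^ (Nat.log 2 s + 1)) :=
          Nat.mul_le_mul_left 4 (Nat.mul_le_mul hnL.le hsL.le)
      _ = 2 ^ (Nat.log 2 n + Nat.log 2 s + 4) := by ring
  calc n + q + s ≤ 4 * (n * s) * q := h1
    _ ≤ 2 ^ (Nat.log 2 n + Nat.log 2 s + 4) * q := Nat.mul_le_mul_right _ h2
    _ ≤ q ^ (Nat.log 2 n + Nat.log 2 s + 4) * q :=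
        Nat.mul_le_mul_right _ (Nat.pow_le_pow_left hq _)
    _ = q ^ (Nat.log 2 n + Nat.log 2 s + 5) := by ring

end CKRST2020

open Finset in
/-- **Discharge of `CKRST2020_lemma11`** (v4 Lemma 3.8 = ECCC Lemma 3.1 = v2 ‹Lemma 11›), with
`C = 40`, following the printed proof: the nonzero members of `𝒞(n,d,s)` form a finite class of at
most `(2q²(n+q+s)²)^s(n+q+s) ≤ q^{(3A+3)s}` polynomials, `A = log₂ n + log₂ s + 5`
(`CircuitCount.exists_finset_complexity_le`), each of degree `≤ d ≤ √q`; `t = 40 s (log₂ n +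
log₂ s + 1)` uniform points of `𝔽^n` hit all of them since `#𝒞 · d^t ≤ q^{(3A+3)s} q^{t/2} <
q^t` (`FiniteClass.exists_hittingSet`).
[cite: ChatterjeeKumarRamyaSaptharishiTengse2020, Lemma 3.8 (arXiv v4) = Lemma 3.1 (ECCC) = v2 ‹Lemma 11›] -/
theorem CKRST2020_lemma11_holds : CKRST2020_lemma11 := by
  classical
  refine ⟨40, fun F _ _ n d s hn hs hdq => ?_⟩
  set q := Fintype.card F with hq
  have hq2 : 2 ≤ q := Fintype.one_lt_card
  -- the finite class
  obtain ⟨𝒞₀, h𝒞₀, hmem⟩ := CircuitCount.exists_finset_complexity_le F (Fin n) s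
  rw [Fintype.card_fin] at h𝒞₀
  set 𝒞 := 𝒞₀.filter (fun f => f ≠ 0 ∧ f.totalDegree ≤ d) with h𝒞
  have h0 : ∀ f ∈ 𝒞, f ≠ 0 := fun f hf => (Finset.mem_filter.1 hf).2.1
  have hd : ∀ f ∈ 𝒞, f.totalDegree ≤ d := fun f hf => (Finset.mem_filter.1 hf).2.2
  -- the count
  set A := Nat.log 2 n + Nat.log 2 s + 5 with hA
  set u := 20 * s * (Nat.log 2 n + Nat.log 2 s + 1) with hu
  have hcard : 𝒞.card ≤ q ^ ((3 * A + 3) * s) :=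
    (Finset.card_filter_le _ _).trans (h𝒞₀.trans
      (CKRST2020.count_le_pow hs hq2 (CKRST2020.n_add_q_add_s_le hn hs hq2)))
  have hau : (3 * A + 3) * s < u := by
    have hsplit : u = (3 * A + 3) * s + (17 * Nat.log 2 n + 17 * Nat.log 2 s + 2) * s := by
      rw [hu, hA]; ring
    have hpos : 0 < (17 * Nat.log 2 n + 17 * Nat.log 2 s + 2) * s := Nat.mul_pos (by omega) hs
    linarith
  have hcount : 𝒞.card * d ^ (2 * u) < (Finset.univ : Finset F).card ^ (2 * u) := by
    rw [Finset.card_univ]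
    exact CKRST2020.card_mul_pow_lt hcard hau hq2 hdq
  obtain ⟨H, -, hHcard, hhit⟩ := FiniteClass.exists_hittingSet 𝒞 h0 hd Finset.univ hcount
  refine ⟨H, hHcard.trans (le_of_eq (by rw [hu]; ring)), fun f hf hf0 => hhit f ?_⟩
  exact Finset.mem_filter.2 ⟨hmem f hf.2, hf0, hf.1⟩

open Finset in
/-- **Discharge of `CKRST2020_lemma16`** (v4 Lemma 3.9 = ECCC Lemma 5.3 = v2 ‹Lemma 16›), with
`C = 40`, following the printed proof: a nonzero `f ∈ 𝒟(n,d,s)` is `Σ_{α ∈ {0,1}^{s-n}} g(x, α)`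
for an `s`-variate `g` of complexity `≤ s` (so `n ≤ s`; for `n > s` the class is empty), whence at
most `(2q²(2s+q)²)^s (2s+q) ≤ q^{(3A+3)s}` such `f`, `A = log₂ s + 3` (v4 Claim 3.11's count, from
`CircuitCount.exists_finset_complexity_le`); `t = 40 s (log₂ s + 1)` uniform points hit them all
(`FiniteClass.exists_hittingSet`, `d² ≤ q`).
[cite: ChatterjeeKumarRamyaSaptharishiTengse2020, Lemma 3.9 (arXiv v4) = Lemma 5.3 (ECCC) = v2 ‹Lemma 16›] -/
theorem CKRST2020_lemma16_holds : CKRST2020_lemma16 := by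
  classical
  refine ⟨40, fun F _ _ n d s hs hdq => ?_⟩
  by_cases hns : n ≤ s
  swap
  · -- no `s`-definable polynomials in more than `s` variables
    exact ⟨∅, by simp, fun f hf _ => absurd hf.2.1 hns⟩
  set q := Fintype.card F with hq
  have hq2 : 2 ≤ q := Fintype.one_lt_card
  -- the finite class: Boolean sums of `s`-variate polynomials of complexity `≤ s`
  obtain ⟨𝒞₀, h𝒞₀, hmem⟩ := CircuitCount.exists_finset_complexity_le F (Fin n ⊕ Fin (s - n)) s
  rw [Fintype.card_sum, Fintype.card_fin, Fintype.card_fin, Nat.add_sub_cancel' hns] at h𝒞₀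
  set 𝒞 := (𝒞₀.image fun g => boolSum g).filter (fun f => f ≠ 0 ∧ f.totalDegree ≤ d) with h𝒞
  have h0 : ∀ f ∈ 𝒞, f ≠ 0 := fun f hf => (Finset.mem_filter.1 hf).2.1
  have hd : ∀ f ∈ 𝒞, f.totalDegree ≤ d := fun f hf => (Finset.mem_filter.1 hf).2.2
  -- the count
  set A := Nat.log 2 s + 3 with hA
  set u := 20 * s * (Nat.log 2 s + 1) with hu
  have hcard : 𝒞.card ≤ q ^ ((3 * A + 3) * s) :=
    (Finset.card_filter_le _ _).trans (Finset.card_image_le.trans (h𝒞₀.trans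
      (CKRST2020.count_le_pow hs hq2 (CKRST2020.two_s_add_q_le hs hq2))))
  have hau : (3 * A + 3) * s < u := by
    have hsplit : u = (3 * A + 3) * s + (17 * Nat.log 2 s + 8) * s := by rw [hu, hA]; ring
    have hpos : 0 < (17 * Nat.log 2 s + 8) * s := Nat.mul_pos (by omega) hs
    linarith
  have hcount : 𝒞.card * d ^ (2 * u) < (Finset.univ : Finset F).card ^ (2 * u) := by
    rw [Finset.card_univ]
    exact CKRST2020.card_mul_pow_lt hcard hau hq2 hdq
  obtain ⟨H, -, hHcard, hhit⟩ := FiniteClass.exists_hittingSet 𝒞 h0 hd Finset.univ hcount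
  refine ⟨H, hHcard.trans (le_of_eq (by rw [hu]; ring)), fun f hf hf0 => hhit f ?_⟩
  obtain ⟨hfd, -, g, -, hgc, hfg⟩ := hf
  refine Finset.mem_filter.2 ⟨Finset.mem_image.2 ⟨g, hmem g hgc, hfg.symm⟩, hf0, hfd⟩

end FiniteFieldHittingSets

end Literature.Barriers.ValiantsHypothesis
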